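import Summits.BirchSwinnertonDyer.Rank1Residual.GaloisImage.TameThreeKodairaShape
import Literature.NumberTheory.DiophantineGeometry.TateAlgorithmRingEquivProofs
import HarnessLib

/-!
# Kodaira types `III` / `III*` at `3`, read at ANY presentation of the place (`ℤ`, `𝓞 ℚ`, …):
# the integer translate in `III`-shape resp. `III*`-shape
# (cell `b2b-bsdres`, team n1011, seat p04 gen 3, OWNERS row T-b9-K 'Kodaira bridge' for T-b9 — twin)

HONEST FRAMING (cell `b2b-bsdres`, run/shared/lean/b2b/bsd-rank1-residual/, verbatim in every
file): the goal of the cell is to DELETE the COMBINATION-SHAPED residual classes of the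
Birch–Swinnerton-Dyer formula for ALL analytic-rank `≤ 1` elliptic curves over `ℚ` — "full BSD
formula for every rank `≤ 1` curve in class `C`" assembled STRICTLY from published theorems — so
that the rank-`≤ 1` remainder becomes exactly the CONSTRUCTION-SHAPED classes, which are TYPED
(missing-input `Prop`s), NOT attempted. This is not "finishing BSD". Team n1011 (N10 / N11, the
additive block X4 ∧ `p = 3`): research route on the CONSTRUCTION-SHAPED class X4; no claim beyond the
stated classes; nothing is booked. Theorems only (no definition, no named fact).

## What this file proves

`TameThreeKodairaShape.lean` reads the Kodaira symbol at a place `v` of `𝓞 ℚ` (where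
`IsGloballyMinimal` lives); the additive sub-cells read conductor exponents and Kodaira symbols at
the place `placeOf p : HeightOneSpectrum ℤ` (`Additive/SharpenedStatements`, `Additive/GordKodairaType`).
This file removes the difference:

* `kodairaSymbolAt_eq_of_natGenerator_eq` — **the Kodaira symbol of `W / ℚ` at a place depends only
  on the rational prime below it**: for integer rings `R, R'` of `ℚ` (`[IsIntegralClosure · ℤ ℚ]`,
  e.g. `ℤ`, `𝓞 ℚ`) and places `v, v'` with `natGenerator v = natGenerator v'`,
  `W.kodairaSymbolAt v = W.kodairaSymbolAt v'` — both are Tate's algorithm over Mathlib's `ℤ_[p]`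
  (tree `kodairaSymbolAt_eq_padic`, Tate 1975 §§7–8);
* `exists_int_translate_IIIShape_three'`, `exists_int_translate_IIIstarShape_three'`,
  `exists_IIIShape_intModel_three'`, `exists_IIIstarShape_intModel_three'` — K1 / K2 / K1+K3 / K2+K3
  of `TameThreeKodairaShape` with the hypothesis `W.kodairaSymbolAt v = III` (resp. `III*`) read at a
  place `v` of ANY integer ring `R` of `ℚ` with `natGenerator v = 3` (in particular at
  `placeOf 3 : HeightOneSpectrum ℤ`).

References: J. Tate, LNM 476 (1975) §§7–8; J. H. Silverman, *ATAEC* IV.9.4.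
-/

noncomputable section

open scoped Classical NumberField

open WeierstrassCurve IsDedekindDomain NumberField Rat.HeightOneSpectrum

namespace Summit.BirchSwinnertonDyer.Rank1Residual.GaloisImage

/-- **The Kodaira symbol at a place of `ℚ` depends only on the rational prime below it**: for
integer rings `R, R'` of `ℚ` (e.g. `ℤ` and `𝓞 ℚ`) and places `v, v'` over the same prime,
`W.kodairaSymbolAt v = W.kodairaSymbolAt v'` (both are Tate's algorithm over `ℤ_[p]`,
`kodairaSymbolAt_eq_padic`). [cite: Tate1975, §§7–8] -/
theorem kodairaSymbolAt_eq_of_natGenerator_eq {R R' : Type*} [CommRing R] [IsDedekindDomain R]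
    [Algebra R ℚ] [IsFractionRing R ℚ] [IsIntegralClosure R ℤ ℚ] [CommRing R'] [IsDedekindDomain R']
    [Algebra R' ℚ] [IsFractionRing R' ℚ] [IsIntegralClosure R' ℤ ℚ]
    (v : HeightOneSpectrum R) (v' : HeightOneSpectrum R') (h : natGenerator v = natGenerator v')
    (W : WeierstrassCurve ℚ) [W.IsElliptic] :
    W.kodairaSymbolAt v = W.kodairaSymbolAt v' := by
  have hpq : primesEquiv v = primesEquiv v' := Subtype.ext h
  rw [kodairaSymbolAt_eq_padic v W, kodairaSymbolAt_eq_padic v' W]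
  have key : ∀ (p q : Nat.Primes), p = q →
      (haveI : Fact p.1.Prime := ⟨p.2⟩
       (W.baseChange ℚ_[p]).kodairaSymbol ℤ_[p]) =
      (haveI : Fact q.1.Prime := ⟨q.2⟩
       (W.baseChange ℚ_[q]).kodairaSymbol ℤ_[q]) := by
    rintro p q rfl; rfl
  exact key _ _ hpq

section AnyPlace

variable {R : Type*} [CommRing R] [IsDedekindDomain R] [Algebra R ℚ] [IsFractionRing R ℚ]
  [IsIntegralClosure R ℤ ℚ]

/-- The place of `𝓞 ℚ` over `3` and its generator. [folklore] -/
theorem natGenerator_primesEquiv_symm_three :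
    natGenerator ((primesEquiv (R := 𝓞 ℚ)).symm ⟨3, Nat.prime_three⟩) = 3 :=
  congrArg Subtype.val ((primesEquiv (R := 𝓞 ℚ)).apply_symm_apply ⟨3, Nat.prime_three⟩)

/-- Transport of a Kodaira symbol at `3` from any presentation of the place to the place of `𝓞 ℚ`.
[folklore] -/
theorem kodairaSymbolAt_primesEquiv_symm_three_eq (v : HeightOneSpectrum R) (W : WeierstrassCurve ℚ)
    [W.IsElliptic] (hv : natGenerator v = 3) :
    W.kodairaSymbolAt ((primesEquiv (R := 𝓞 ℚ)).symm ⟨3, Nat.prime_three⟩) = W.kodairaSymbolAt v :=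
  kodairaSymbolAt_eq_of_natGenerator_eq _ _ ((natGenerator_primesEquiv_symm_three).trans hv.symm) W

/-- **K1 at `3`, any presentation of the place** (e.g. `v = placeOf 3` over `ℤ`): Kodaira type `III`
⟹ an integer translate `(1; r, 0, 0) • integralModelInt W` with `3 ∣ b₂, 3 ∣ b₄, ¬ 9 ∣ b₄, 9 ∣ b₆`.
[cite: SilvermanATAEC1994, IV.9.4 Steps 2–4] -/
theorem exists_int_translate_IIIShape_three' (v : HeightOneSpectrum R) (W : WeierstrassCurve ℚ)
    [W.IsElliptic] [W.IsGloballyMinimal] (hv : natGenerator v = 3)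
    (hW : W.kodairaSymbolAt v = .III) :
    ∃ r : ℤ,
      (3 : ℤ) ∣ ((⟨1, r, 0, 0⟩ : VariableChange ℤ) • integralModelInt W).b₂ ∧
      (3 : ℤ) ∣ ((⟨1, r, 0, 0⟩ : VariableChange ℤ) • integralModelInt W).b₄ ∧
      ¬ (9 : ℤ) ∣ ((⟨1, r, 0, 0⟩ : VariableChange ℤ) • integralModelInt W).b₄ ∧
      (9 : ℤ) ∣ ((⟨1, r, 0, 0⟩ : VariableChange ℤ) • integralModelInt W).b₆ :=
  exists_int_translate_IIIShape_three _ W natGenerator_primesEquiv_symm_three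
    ((kodairaSymbolAt_primesEquiv_symm_three_eq v W hv).trans hW)

/-- **K2 at `3`, any presentation of the place**: Kodaira type `III*` ⟹ an integer translate with
`9 ∣ b₂, 27 ∣ b₄, ¬ 81 ∣ b₄, 243 ∣ b₆`. [cite: SilvermanATAEC1994, IV.9.4 Steps 6–9] -/
theorem exists_int_translate_IIIstarShape_three' (v : HeightOneSpectrum R) (W : WeierstrassCurve ℚ)
    [W.IsElliptic] [W.IsGloballyMinimal] (hv : natGenerator v = 3)
    (hW : W.kodairaSymbolAt v = .IIIstar) :
    ∃ r : ℤ,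
      (9 : ℤ) ∣ ((⟨1, r, 0, 0⟩ : VariableChange ℤ) • integralModelInt W).b₂ ∧
      (27 : ℤ) ∣ ((⟨1, r, 0, 0⟩ : VariableChange ℤ) • integralModelInt W).b₄ ∧
      ¬ (81 : ℤ) ∣ ((⟨1, r, 0, 0⟩ : VariableChange ℤ) • integralModelInt W).b₄ ∧
      (243 : ℤ) ∣ ((⟨1, r, 0, 0⟩ : VariableChange ℤ) • integralModelInt W).b₆ :=
  exists_int_translate_IIIstarShape_three _ W natGenerator_primesEquiv_symm_three
    ((kodairaSymbolAt_primesEquiv_symm_three_eq v W hv).trans hW)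

/-- **K1 + K3 packaged at `3`, any presentation of the place.** [cite: SilvermanATAEC1994, IV.9.4 Steps 2–4] -/
theorem exists_IIIShape_intModel_three' (v : HeightOneSpectrum R) (W : WeierstrassCurve ℚ)
    [W.IsElliptic] [W.IsGloballyMinimal] (hv : natGenerator v = 3)
    (hW : W.kodairaSymbolAt v = .III) :
    ∃ V : WeierstrassCurve ℤ, (∃ r : ℤ, V = (⟨1, r, 0, 0⟩ : VariableChange ℤ) • integralModelInt W ∧
        V.map (Int.castRingHom ℚ) = (⟨1, (r : ℚ), 0, 0⟩ : VariableChange ℚ) • W) ∧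
      (3 : ℤ) ∣ V.b₂ ∧ (3 : ℤ) ∣ V.b₄ ∧ ¬ (9 : ℤ) ∣ V.b₄ ∧ (9 : ℤ) ∣ V.b₆ ∧
      (V.map (Int.castRingHom ℚ)).IsElliptic ∧
      ∀ n : ℤ, (V.map (Int.castRingHom ℚ)).HasSurjectiveModNGaloisRep n ↔
        W.HasSurjectiveModNGaloisRep n :=
  exists_IIIShape_intModel_three W _ natGenerator_primesEquiv_symm_three
    ((kodairaSymbolAt_primesEquiv_symm_three_eq v W hv).trans hW)

/-- **K2 + K3 packaged at `3`, any presentation of the place.** [cite: SilvermanATAEC1994, IV.9.4 Steps 6–9] -/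
theorem exists_IIIstarShape_intModel_three' (v : HeightOneSpectrum R) (W : WeierstrassCurve ℚ)
    [W.IsElliptic] [W.IsGloballyMinimal] (hv : natGenerator v = 3)
    (hW : W.kodairaSymbolAt v = .IIIstar) :
    ∃ V : WeierstrassCurve ℤ, (∃ r : ℤ, V = (⟨1, r, 0, 0⟩ : VariableChange ℤ) • integralModelInt W ∧
        V.map (Int.castRingHom ℚ) = (⟨1, (r : ℚ), 0, 0⟩ : VariableChange ℚ) • W) ∧
      (9 : ℤ) ∣ V.b₂ ∧ (27 : ℤ) ∣ V.b₄ ∧ ¬ (81 : ℤ) ∣ V.b₄ ∧ (243 : ℤ) ∣ V.b₆ ∧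
      (V.map (Int.castRingHom ℚ)).IsElliptic ∧
      ∀ n : ℤ, (V.map (Int.castRingHom ℚ)).HasSurjectiveModNGaloisRep n ↔
        W.HasSurjectiveModNGaloisRep n :=
  exists_IIIstarShape_intModel_three W _ natGenerator_primesEquiv_symm_three
    ((kodairaSymbolAt_primesEquiv_symm_three_eq v W hv).trans hW)

end AnyPlace

end Summit.BirchSwinnertonDyer.Rank1Residual.GaloisImage

end
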